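import Literature.NumberTheory.QuadraticFields.RingClassForms
import Literature.NumberTheory.NumberFields.RingClassFieldOfConductor
import HarnessLib

/-!
# Cox's Prop. 7.22 at a DIVISOR of the conductor: forms of discriminant `f² d_K` with the same class and first
# coefficient prime to `d ∣ f` have the same ideal class in `I_K(d)/P_{K,ℤ}(d)` — the class-restriction map read on forms
# (crux `UpperOffV0HSYPlus`, stmt-BirchSwinnertonDyer-19804; route `SylvesterTwoHeegnerIndex`, rung K7t; (W2-b) route (4.2))

Cell `bsd-cm`, seat `bsd-cm-k7t-c2` g33 (PLAN Ω′ piece (III-a), STATUS 2026-08-29T23:36Z).  Helper toward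
`stmt-BirchSwinnertonDyer-19804` (`--supports … --as helper`).  THEOREMS ONLY (no definition, no named fact, no instance,
no `sorry`).

WHAT.  Data as in `QuadraticFields/RingClassOrder.lean` / `RingClassForms.lean`: `K` a quadratic field with integral basis
`(1, b₁)`, `b₁² = m + t b₁`, a conductor `f`, `Δ.D = f²(t² + 4m)`, `2s = Δ.D − f t`, the embedding `ι : O_Δ → 𝓞 K`
(`ω_Δ ↦ f b₁ + s`), and for a primitive positive definite form `q` of discriminant `Δ.D` its ideal `𝔄_q = 𝔞_q 𝓞_K =
(fIdeal Δ q).map ι`.  `RingClassForms.mk_eq_of_properEquiv` proves: equal classes in `Cl(O_Δ)` and `gcd(a, f) = 1` ⇒ equal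
classes `[𝔄_q] ∈ I_K(f)/P_{K,ℤ}(f)`.  HERE the modulus is any `d` with `f ∈ d𝓞_K` (e.g. `d ∣ f`), and the forms only need
`gcd(a, d) = 1` — which admits forms whose `a` shares a prime with `f/d` (the use: the ambiguous form `(243, 243m, 61m²)` of
discriminant `−243m²` at the modulus `m`, `3 ∤ m`):

* (`RingClass.map_fIdeal_sup_eq_top`: `𝔄_q` is prime to `d` when `gcd(a_q, d) = 1`);
* ★ `idealClass_map_fIdeal_eq_of_classOf'_eq` — **`classOf' Δ q₁ = classOf' Δ q₂`, `gcd(aᵢ, d) = 1`, `f ∈ (d)` ⇒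
  `[𝔄_{q₁}] = [𝔄_{q₂}]` in `I_K(d)/P_{K,ℤ}(d)`** (Cox's proof of Prop. 7.22 verbatim with the modulus weakened: `a₂𝔞₁ = γ𝔞₂`
  with `γ ≡ c (mod f)`, hence `(mod d)`, and `c` prime to `d`);
* `idealClass_map_fIdeal_eq_primeClass` — for the form `q_u` of a degree-one prime `u ∤ d` (`𝔄_{q_u} = 𝔭_u`):
  `[𝔄_{q_u}] = primeClass d u`;
* ★ `primeClass_eq_idealClass_of_classOf'_eq` — hence `classOf' Δ q_u = classOf' Δ q` (`gcd(a_q, d) = 1`) ⇒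
  `primeClass d u = [𝔄_q]_d`: the RING CLASS of a Chebotarev prime at level `d` is read off ANY form in its level-`f` class.

This is the map `θ̃ : Cl(𝒪_{f²d_K}) ⇢ I_K(d)/P_{K,ℤ}(d)` of the seat's PLAN Ω′ «as a class-invariant function on forms with
`gcd(a, d) = 1`» — no homomorphism / kernel count is claimed or needed.

HONEST LABEL: generic bookkeeping (Cox §7.C); no stub closed; nothing asserted on 19804; X12.CMAtTwo NOT proved; BSD is proved
for no curve.

## References
* D. A. Cox, *Primes of the form x² + ny²*, 2nd ed. (2013), §7.B Thm. 7.7, §7.C Lemma 7.18, Prop. 7.20, Prop. 7.22 (proof),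
  §7.D (7.27). [Cox2013]
-/

set_option autoImplicit false
-- the Summit-side namespace `Summit.BirchSwinnertonDyer.BirchSwinnertonDyer.…` (summit = problem) is mandated by D-0017
set_option linter.dupNamespace false

noncomputable section

open scoped Classical QuadraticAlgebra nonZeroDivisors NumberField

namespace Summit.BirchSwinnertonDyer.BirchSwinnertonDyer.Theorems.SylvesterTwoLevelFixingRestrict

open Module NumberField QuadraticAlgebra Ideal IsDedekindDomain IsDedekindDomain.HeightOneSpectrum
  Literature.Computability.Cryptography.Hallgren2005 Literature.Computability.Cryptography.Hallgren2005.OrderCl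
  Literature.Computability.Cryptography.Hallgren2005.Reduction
  Literature.NumberTheory.QuadraticFields.Quadratic Literature.NumberTheory.QuadraticFields.Quadratic.BinQF
  Literature.NumberTheory.QuadraticFields.RingClass
  Literature.NumberTheory.NumberFields Literature.NumberTheory.NumberFields.RingClassField

variable {K : Type} [Field K] [NumberField K]
variable (b : Basis (Fin 2) ℤ (𝓞 K)) (hb : b 0 = 1) {t m : ℤ}
variable {f : ℕ} {Δ : NegDiscr} {s : ℤ}
variable (ι : QO Δ →+* 𝓞 K) (hι : ι ω = (f : 𝓞 K) * b 1 + (s : 𝓞 K))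
variable {d : ℕ} (hfd : (f : 𝓞 K) ∈ Ideal.span {(d : 𝓞 K)})

/-! ## §1 The class `[𝔄_q]_d` -/

/-- The class `[𝔄_q] ∈ I_K(d)/P_{K,ℤ}(d)` of a form with `gcd(a_q, d) = 1` is the tree's `idealClass d`. (Unfolding.)
[cite: Cox2013, §7.C Prop. 7.22] -/
theorem idealClass_map_fIdeal_eq_mk {q : BinQF} (hq : q.IsPosPrim Δ.D) (hqa : IsCoprime q.a (d : ℤ)) :
    idealClass d (map_fIdeal_ne_bot ι hq) (map_fIdeal_sup_eq_top ι hqa) =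
      QuotientGroup.mk ⟨FractionalIdeal.mk0 K ⟨(fIdeal Δ q).map ι, mem_nonZeroDivisors_of_ne_bot (map_fIdeal_ne_bot ι hq)⟩,
        mk0_mem_ringClassNum (map_fIdeal_sup_eq_top ι hqa) (map_fIdeal_ne_bot ι hq)⟩ :=
  idealClass_eq d _ _

/-! ## §2 ★ Class invariance at the modulus `d`, `f ∈ (d)` -/

include hb hι hfd in
/-- ★ **Equal classes in `Cl(O_Δ)` ⇒ equal classes in `I_K(d)/P_{K,ℤ}(d)`** for forms `q₁, q₂` of discriminant `Δ.D = f² d_K`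
with `gcd(aᵢ, d) = 1`, whenever `f ∈ d𝓞_K`.  Cox's proof of Prop. 7.22: `x𝔞₁ = y𝔞₂` in `O_Δ` gives `a₂𝔞₁ = γ𝔞₂` with
`γ ∈ O_Δ`, so `ι γ ≡ c (mod f𝓞_K)` for an integer `c` with `c c' ≡ a₁a₂ (mod f)`; read modulo `d`: `ι γ ≡ c (mod d)` and
`gcd(c, d) = 1`, so `(ι γ), (a₂) ∈ P_{K,ℤ}(d)`. [cite: Cox2013, §7.C Prop. 7.22 (proof) and §7.D (7.27)] -/
theorem idealClass_map_fIdeal_eq_of_classOf'_eq (hf : f ≠ 0) {q₁ q₂ : BinQF} (h₁ : q₁.IsPosPrim Δ.D)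
    (h₂ : q₂.IsPosPrim Δ.D) (ha₁ : IsCoprime q₁.a (d : ℤ)) (ha₂ : IsCoprime q₂.a (d : ℤ))
    (hcl : classOf' Δ q₁ = classOf' Δ q₂) :
    idealClass d (map_fIdeal_ne_bot ι h₁) (map_fIdeal_sup_eq_top ι ha₁) =
      idealClass d (map_fIdeal_ne_bot ι h₂) (map_fIdeal_sup_eq_top ι ha₂) := by
  have hfd' : Ideal.span {(f : 𝓞 K)} ≤ Ideal.span {(d : 𝓞 K)} := (Ideal.span_singleton_le_iff_mem _).2 hfd
  obtain ⟨e, he⟩ : (d : ℤ) ∣ (f : ℤ) := by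
    have h := (intCast_mem_span_iff b hb (f := d) (f : ℤ)).1 (by push_cast; exact hfd)
    exact h
  obtain ⟨x, y, hx, hy, hxy⟩ := (classOf'_eq_classOf'_iff Δ h₁ h₂).1 hcl
  set 𝔞₁ := fIdeal Δ q₁ with h𝔞₁
  set 𝔞₂ := fIdeal Δ q₂ with h𝔞₂
  set 𝔞₂' := fIdeal Δ (negForm q₂) with h𝔞₂'
  have h22 : 𝔞₂ * 𝔞₂' = Ideal.span {(q₂.a : QO Δ)} := fIdeal_mul_negForm Δ h₂
  have hx1 : Ideal.span {x} * (𝔞₁ * 𝔞₂') = Ideal.span {y * (q₂.a : QO Δ)} := by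
    rw [← mul_assoc, hxy, mul_assoc, h22, Ideal.span_singleton_mul_span_singleton]
  obtain ⟨γ, hγmem, hxγ⟩ := Ideal.mem_span_singleton_mul.1 (hx1 ▸ Ideal.mem_span_singleton_self (y * (q₂.a : QO Δ)))
  have hprod : 𝔞₁ * 𝔞₂' = Ideal.span {γ} := by
    apply (Ideal.span_singleton_mul_right_inj hx).1
    rw [hx1, ← hxγ, Ideal.span_singleton_mul_span_singleton]
  have key : Ideal.span {(q₂.a : QO Δ)} * 𝔞₁ = Ideal.span {γ} * 𝔞₂ := by
    calc Ideal.span {(q₂.a : QO Δ)} * 𝔞₁ = (𝔞₁ * 𝔞₂') * 𝔞₂ := by rw [← h22]; ring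
      _ = Ideal.span {γ} * 𝔞₂ := by rw [hprod]
  -- transport to `𝓞 K`
  have keyK : Ideal.span {((q₂.a : ℤ) : 𝓞 K)} * 𝔞₁.map ι = Ideal.span {ι γ} * 𝔞₂.map ι := by
    have := congrArg (Ideal.map ι) key
    rwa [Ideal.map_mul, Ideal.map_mul, Ideal.map_span, Ideal.map_span, Set.image_singleton,
      Set.image_singleton, map_intCast] at this
  -- `γ ≠ 0`, `γ ≡ c (mod f)`, hence `(mod d)`, with `c` prime to `d`
  have ha₁0 : (q₁.a : QO Δ) ≠ 0 := intCast_ne_zero Δ h₁.a_pos.ne'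
  have ha₂0 : (q₂.a : QO Δ) ≠ 0 := intCast_ne_zero Δ h₂.a_pos.ne'
  have hmem₁ : (q₁.a : QO Δ) ∈ 𝔞₁ := Ideal.subset_span (by simp)
  have hmem₂' : (q₂.a : QO Δ) ∈ 𝔞₂' := Ideal.subset_span (by simp [negForm])
  have hγ0 : γ ≠ 0 := by
    intro h0
    rw [h0, Ideal.span_singleton_zero, Ideal.mul_eq_bot] at hprod
    rcases hprod with h' | h'
    · rw [h'] at hmem₁; exact ha₁0 ((Submodule.mem_bot _).1 hmem₁)
    · rw [h'] at hmem₂'; exact ha₂0 ((Submodule.mem_bot _).1 hmem₂')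
  have hιγ0 : ι γ ≠ 0 := fun h0 => hγ0 (emb_injective b hb ι hι hf (by rw [h0, map_zero]))
  have ha₂K0 : ((q₂.a : ℤ) : 𝓞 K) ≠ 0 := fun h0 => h₂.a_pos.ne' (intCast_eq_zero_of_basis b hb h0)
  obtain ⟨δ, hδ⟩ : ∃ δ : QO Δ, δ * γ = (q₁.a : QO Δ) * (q₂.a : QO Δ) := by
    rw [← Ideal.mem_span_singleton', ← hprod]
    exact Ideal.mul_mem_mul hmem₁ hmem₂'
  set c : ℤ := γ.re + γ.im * s with hc
  set c' : ℤ := δ.re + δ.im * s with hc'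
  have hγc : ι γ - (c : 𝓞 K) ∈ Ideal.span {(f : 𝓞 K)} := emb_sub_intCast_mem b ι hι γ
  have hδc : ι δ - (c' : 𝓞 K) ∈ Ideal.span {(f : 𝓞 K)} := emb_sub_intCast_mem b ι hι δ
  have hcf : IsCoprime c (d : ℤ) := by
    have hprodK : ((q₁.a * q₂.a : ℤ) : 𝓞 K) - ((c' * c : ℤ) : 𝓞 K) ∈ Ideal.span {(f : 𝓞 K)} := by
      have e1 : ((q₁.a * q₂.a : ℤ) : 𝓞 K) = ι δ * ι γ := by
        rw [← map_mul, hδ]; push_cast; rw [map_mul, map_intCast, map_intCast]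
      have : ((q₁.a * q₂.a : ℤ) : 𝓞 K) - ((c' * c : ℤ) : 𝓞 K) = ι δ * (ι γ - c) + (c : 𝓞 K) * (ι δ - c') := by
        rw [e1]; push_cast; ring
      rw [this]
      exact Ideal.add_mem _ (Ideal.mul_mem_left _ _ hγc) (Ideal.mul_mem_left _ _ hδc)
    obtain ⟨k, hk⟩ := (intCast_mem_span_iff b hb (q₁.a * q₂.a - c' * c)).1 (by push_cast at hprodK ⊢; exact hprodK)
    have : c' * c = q₁.a * q₂.a + (-(k * e)) * d := by rw [he] at hk; linarith
    have hcc : IsCoprime (c' * c) (d : ℤ) := this ▸ (ha₁.mul_left ha₂).add_mul_right_left (-(k * e))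
    exact hcc.of_mul_left_right
  -- conclude in `I_K(d)/P_{K,ℤ}(d)`
  rw [idealClass_map_fIdeal_eq_mk ι h₁ ha₁, idealClass_map_fIdeal_eq_mk ι h₂ ha₂, QuotientGroup.eq, Subgroup.mem_subgroupOf]
  show (FractionalIdeal.mk0 K ⟨𝔞₁.map ι, _⟩)⁻¹ * FractionalIdeal.mk0 K ⟨𝔞₂.map ι, _⟩ ∈ ringClassDen K d
  have hunits : prin K ((q₂.a : ℤ) : 𝓞 K) ha₂K0 *
      FractionalIdeal.mk0 K ⟨𝔞₁.map ι, mem_nonZeroDivisors_of_ne_bot (map_fIdeal_ne_bot ι h₁)⟩ =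
      prin K (ι γ) hιγ0 * FractionalIdeal.mk0 K ⟨𝔞₂.map ι, mem_nonZeroDivisors_of_ne_bot (map_fIdeal_ne_bot ι h₂)⟩ := by
    apply Units.ext
    simp only [Units.val_mul, coe_prin', FractionalIdeal.coe_mk0]
    rw [← FractionalIdeal.coeIdeal_mul, ← FractionalIdeal.coeIdeal_mul, keyK]
  set U₁ := FractionalIdeal.mk0 K ⟨𝔞₁.map ι, mem_nonZeroDivisors_of_ne_bot (map_fIdeal_ne_bot ι h₁)⟩ with hU₁
  set U₂ := FractionalIdeal.mk0 K ⟨𝔞₂.map ι, mem_nonZeroDivisors_of_ne_bot (map_fIdeal_ne_bot ι h₂)⟩ with hU₂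
  set P := prin K ((q₂.a : ℤ) : 𝓞 K) ha₂K0 with hP
  set Q := prin K (ι γ) hιγ0 with hQ
  have hrel : U₁⁻¹ * U₂ = Q⁻¹ * P := by
    calc U₁⁻¹ * U₂ = U₁⁻¹ * (Q⁻¹ * (Q * U₂)) := by rw [inv_mul_cancel_left]
      _ = U₁⁻¹ * (Q⁻¹ * (P * U₁)) := by rw [hunits]
      _ = Q⁻¹ * P := by rw [mul_comm P U₁, mul_left_comm Q⁻¹ U₁ P, inv_mul_cancel_left]
  rw [hrel]
  exact Subgroup.mul_mem _ (Subgroup.inv_mem _ (prin_mem_ringClassDen hιγ0 hcf (hfd' hγc)))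
    (prin_mem_ringClassDen ha₂K0 ha₂ (by rw [sub_self]; exact Submodule.zero_mem _))

/-! ## §3 Reading a degree-one prime: `[𝔄_{q_u}]_d = primeClass d u` -/

/-- **`[𝔄_q]_d = primeClass d u`** when `𝔄_q = 𝔭_u` for a prime `u ∤ d`. [cite: Cox2013, §7.C Prop. 7.22] -/
theorem idealClass_map_fIdeal_eq_primeClass {q : BinQF} (hq : q.IsPosPrim Δ.D) (hqa : IsCoprime q.a (d : ℤ))
    {u : HeightOneSpectrum (𝓞 K)} (hu : (fIdeal Δ q).map ι = u.asIdeal) :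
    idealClass d (map_fIdeal_ne_bot ι hq) (map_fIdeal_sup_eq_top ι hqa) = primeClass d u := by
  have hcop : u.asIdeal ⊔ Ideal.span {(d : 𝓞 K)} = ⊤ := by rw [← hu]; exact map_fIdeal_sup_eq_top ι hqa
  rw [primeClass_of_sup_eq_top d hcop, idealClass_eq, idealClass_eq]
  congr 2
  exact congrArg _ (Subtype.ext hu)

include hb hι hfd in
/-- ★ **The ring class of a prime at the modulus `d`, read on any form in its level-`f` class**: if `𝔄_{q_u} = 𝔭_u`
(`q_u` primitive positive definite of discriminant `f² d_K`, `gcd(a, d) = 1`) and `classOf' Δ q_u = classOf' Δ q` with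
`gcd(a_q, d) = 1`, then `primeClass d u = [𝔄_q]_d`. [cite: Cox2013, §7.C Prop. 7.22] -/
theorem primeClass_eq_idealClass_of_classOf'_eq (hf : f ≠ 0) {qu q : BinQF} (hqu : qu.IsPosPrim Δ.D)
    (hqua : IsCoprime qu.a (d : ℤ)) {u : HeightOneSpectrum (𝓞 K)} (hu : (fIdeal Δ qu).map ι = u.asIdeal)
    (hq : q.IsPosPrim Δ.D) (hqa : IsCoprime q.a (d : ℤ)) (hcl : classOf' Δ qu = classOf' Δ q) :
    primeClass d u = idealClass d (map_fIdeal_ne_bot ι hq) (map_fIdeal_sup_eq_top ι hqa) := by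
  rw [← idealClass_map_fIdeal_eq_primeClass ι hqu hqua hu]
  exact idealClass_map_fIdeal_eq_of_classOf'_eq b hb ι hι hfd hf hqu hq hqua hqa hcl

include hb hι hfd in
/-- **Two primes whose forms have the same class have the same ring class at the modulus `d`.**
[cite: Cox2013, §7.C Prop. 7.22] -/
theorem primeClass_eq_primeClass_of_classOf'_eq (hf : f ≠ 0) {q₁ q₂ : BinQF} (h₁ : q₁.IsPosPrim Δ.D)
    (h₂ : q₂.IsPosPrim Δ.D) (ha₁ : IsCoprime q₁.a (d : ℤ)) (ha₂ : IsCoprime q₂.a (d : ℤ))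
    {u₁ u₂ : HeightOneSpectrum (𝓞 K)} (hu₁ : (fIdeal Δ q₁).map ι = u₁.asIdeal) (hu₂ : (fIdeal Δ q₂).map ι = u₂.asIdeal)
    (hcl : classOf' Δ q₁ = classOf' Δ q₂) : primeClass d u₁ = primeClass d u₂ := by
  rw [← idealClass_map_fIdeal_eq_primeClass ι h₁ ha₁ hu₁, ← idealClass_map_fIdeal_eq_primeClass ι h₂ ha₂ hu₂]
  exact idealClass_map_fIdeal_eq_of_classOf'_eq b hb ι hι hfd hf h₁ h₂ ha₁ ha₂ hcl

end Summit.BirchSwinnertonDyer.BirchSwinnertonDyer.Theorems.SylvesterTwoLevelFixingRestrict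

end
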